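import Literature.NumberTheory.EllipticCurves.BSDConductorOggSaitoProofs
import Literature.NumberTheory.EllipticCurves.BSDConductorIsEllipticProofs
import HarnessLib

/-!
# bsd.S15 (d), corrected ideal form `𝔣(E/ℚ) = 𝔣^{(ℓ)}(V_ℓ E) · (ℓ)^{f_ℓ}`: the shape of its discharge

`Proofs` file (theorems only, no definitions, no named facts) in topic
`NumberTheory/EllipticCurves`, landed by the tenured seat of the bsd.S15 fact
`Literature.NumberTheory.EllipticCurves.conductor_eq_conductorOf_mul_of_isElliptic W ℓ`
(`BSDConductor`): *for an elliptic curve `E/ℚ` given by `W` (ellipticity quantified in the body)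
and every prime `ℓ`, the conductor ideal `𝔣(E/ℚ) = ∏_v v^{f_v}` of `𝓞 ℚ` (item G22, `f_v` defined
by Ogg's formula `ord_v Δ_min + 1 - m_v`) is the prime-to-`ℓ` Artin conductor
`𝔣^{(ℓ)}(V_ℓ E) = ∏_{v ∤ ℓ} v^{a_v(V_ℓ E)}` (item C15) times `v_ℓ^{f_ℓ}`* — Silverman, *Advanced
Topics in the Arithmetic of Elliptic Curves*, §IV.10: Definition of `ε, δ, f = ε + δ` and
Thm. 10.2 (PDF p. 358 of the held copy), Definition of `𝔣(E/K)` (p. 364); §IV.11, Ogg's formula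
11.1 (p. 365) and its proof (pp. 366–371).

After `InertiaInvariantsMultiplicativeProofs`, `KodairaNeronAdditiveProofs`,
`InertiaInvariantsAdditiveProofs`, `HasseWeilAbelianConductorOggSaito` and
`BSDConductorOggSaitoProofs` every input of Silverman's Chapter IV route to this fact is a theorem
of the tree except Ogg's formula for the wild part at the additive places of residue
characteristic `2` and `3` — the named fact
`WeierstrassCurve.swanConductorAt_rationalTate_eq_wildConductorExponent_of_ringChar_eq W ℓ`
(`HasseWeilAbelianConductor`, "the leaf" `hW23`), split in `HasseWeilAbelianConductorOggSaito` into
its `p = 3` half (`…_of_ringChar_eq_three`, Ogg 1967, **proved** in the book, pp. 366–371) and its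
`p = 2` half (`…_of_ringChar_eq_two`, Saito 1988, only **cited** by the book, p. 366).  This file
records, for the corrected ideal form itself (the sibling `BSDConductorOggSaitoProofs` does so for
the numerical form `conductorNorm_eq_artinConductorNat_of_isElliptic` and for the schemas), the
resulting shape of its discharge:

* `conductor_eq_conductorOf_mul_of_isElliptic_of_ringChar_eq` — **from the leaf alone**; the
  discharge `conductor_eq_conductorOf_mul_of_isElliptic_holds` is this theorem fed with the
  discharge of the leaf;
* `conductor_eq_conductorOf_mul_of_isElliptic_of_two_of_three` — from the two halves (Saito at
  `2`, Ogg at `3`);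
* `conductor_eq_conductorOf_mul_of_isElliptic_of_three_of_forall_not_hasAdditiveReductionAt_two`,
  `…_of_three_of_not_hasAdditiveReductionAt_two` — from Ogg's `p = 3` theorem alone when `W` is
  not additive at `2` (Saito's half vacuous), the latter with the hypothesis on the place
  `v₂ = primesEquiv.symm 2` of `ℚ`;
* `conductor_eq_conductorOf_mul_of_isElliptic_of_not_hasAdditiveReductionAt_two_three`,
  `…_of_isSemistable` — **unconditionally** for a `W / ℚ` that is not additive at `v₂` and `v₃`
  (e.g. semistable), complementing the residue-characteristic form
  `conductor_eq_conductorOf_mul_of_isElliptic_of_forall_not_hasAdditiveReductionAt` of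
  `BSDConductorOggSaitoProofs`.

* `WeierstrassCurve.swanConductorAt_rationalTate_eq_wildConductorExponent_of_ringChar_eq_two_two`,
  `…_of_ringChar_eq_three_three` — **at `ℓ = p` the corresponding half of the leaf is vacuous**
  (over every number field `K`): the halves only speak about places `v ∤ ℓ`, and a place of
  residue characteristic `p` contains `p`; hence `…_of_ringChar_eq_two_iff_three` (the leaf at
  `ℓ = 2` **is** Ogg's `p = 3` theorem at `ℓ = 2`, i.e. exactly the computation printed on
  pp. 366–371, which takes `ℓ = 2`, `L = K(E[2])`) and `…_of_ringChar_eq_three_iff_two` (the leaf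
  at `ℓ = 3` is Saito's theorem at `ℓ = 3`);
* `conductor_eq_conductorOf_mul_of_isElliptic_two_of_three` — **the `ℓ = 2` instance of the fact,
  for every `W / ℚ`, from Ogg's printed `p = 3` computation at `ℓ = 2` alone** (neither Saito's
  theorem nor the `ℓ`-independence Thm. IV.10.2(c) enters: in `𝔣(E/ℚ) = 𝔣^{(2)}(V_2 E) · v_2^{f_2}`
  the place `2` is the exempted one), and `conductor_eq_conductorOf_mul_of_isElliptic_three_of_two`
  — the `ℓ = 3` instance from Saito's half at `ℓ = 3` alone.

## References

* J. H. Silverman, *Advanced Topics in the Arithmetic of Elliptic Curves*, GTM 151 (1994), §IV.10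
  (Definition and Thm. 10.2, PDF p. 358; Definition of `𝔣(E/K)` and Example 10.5, p. 364), §IV.11
  (Ogg's formula 11.1, p. 365, and its proof, pp. 366–371). [SilvermanATAEC1994]
* A. P. Ogg, *Elliptic curves and wild ramification*, Amer. J. Math. 89 (1967). [OggAJM1967]
* T. Saito, *Conductor, discriminant, and the Noether formula of arithmetic surfaces*, Duke Math.
  J. 57 (1988), Theorem 1. [Saito1988]

## Design

No definitions; one-line assemblies; `noncomputable section`; namespace
`Literature.NumberTheory.EllipticCurves` (that of `BSDConductor`); `[W.IsElliptic]` is introduced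
from the body of the corrected fact.
-/

noncomputable section

open scoped Classical NumberField
open NumberField IsDedekindDomain Field

namespace Literature.NumberTheory.EllipticCurves

open WeierstrassCurve

variable (W : WeierstrassCurve ℚ) (ℓ : ℕ) [Fact ℓ.Prime]

/-- **bsd.S15 (d), corrected ideal form, from the leaf alone.**  For every `W / ℚ` and every prime
`ℓ`, `conductor_eq_conductorOf_mul_of_isElliptic W ℓ` (`𝔣(E/ℚ) = 𝔣^{(ℓ)}(V_ℓ E) · v_ℓ^{f_ℓ}` for
elliptic `W`; Silverman *ATAEC* §IV.10 Definition of the conductor, PDF p. 364, with Thm. 10.2 and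
Ogg's formula 11.1) follows from Ogg's formula for the wild part at the additive places of residue
characteristic `2, 3` (`hW23`) alone: the three-leaf assembly
`conductor_eq_conductorOf_mul_of_isElliptic_of_codim_of_ogg` (`BSDConductorIsEllipticProofs`) fed
with the theorems `codimFixed_inertia_rationalTate_eq_one_of_hasMultiplicativeReductionAt_holds`
(`InertiaInvariantsMultiplicativeProofs`), `codimFixed_inertia_rationalTate_eq_two_of_hasAdditiveReductionAt_holds`
(`InertiaInvariantsAdditiveProofs`) and Ogg's formula at all additive places assembled from its
residue-characteristic-`2, 3` part (`swanConductorAt_rationalTate_eq_wildConductorExponent_of_hasAdditiveReductionAt_of_ringChar`,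
`HasseWeilAbelianConductorProofs`, fed with Thm. IV.10.2(b), clause `p ≥ 5`, the theorem
`swanConductorAt_rationalTate_eq_zero_of_ringChar_ne_holds` of `InertiaInvariantsMultiplicativeProofs`).  The
discharge `conductor_eq_conductorOf_mul_of_isElliptic_holds` is this theorem fed with the discharge
of `hW23`.
[cite: SilvermanATAEC1994, §IV.10 Definition of the conductor (PDF p. 364) with Thm. IV.10.2 and Thm. IV.11.1 (pp. 358–371)] -/
theorem conductor_eq_conductorOf_mul_of_isElliptic_of_ringChar_eq
    (hW23 : W.swanConductorAt_rationalTate_eq_wildConductorExponent_of_ringChar_eq ℓ) :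
    conductor_eq_conductorOf_mul_of_isElliptic W ℓ :=
  conductor_eq_conductorOf_mul_of_isElliptic_of_codim_of_ogg W ℓ
    (W.codimFixed_inertia_rationalTate_eq_one_of_hasMultiplicativeReductionAt_holds ℓ)
    (W.codimFixed_inertia_rationalTate_eq_two_of_hasAdditiveReductionAt_holds ℓ)
    (W.swanConductorAt_rationalTate_eq_wildConductorExponent_of_hasAdditiveReductionAt_of_ringChar ℓ
      (W.swanConductorAt_rationalTate_eq_zero_of_ringChar_ne_holds ℓ) hW23)

/-- **bsd.S15 (d), corrected ideal form, from Ogg's `p = 3` theorem and Saito's `p = 2` theorem**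
(the two halves of the leaf, `HasseWeilAbelianConductorOggSaito`).
[cite: SilvermanATAEC1994, §IV.10 Definition of the conductor (PDF p. 364) with Thm. IV.10.2 and Thm. IV.11.1 (pp. 358–371)] -/
theorem conductor_eq_conductorOf_mul_of_isElliptic_of_two_of_three
    (h2 : W.swanConductorAt_rationalTate_eq_wildConductorExponent_of_ringChar_eq_two ℓ)
    (h3 : W.swanConductorAt_rationalTate_eq_wildConductorExponent_of_ringChar_eq_three ℓ) :
    conductor_eq_conductorOf_mul_of_isElliptic W ℓ :=
  conductor_eq_conductorOf_mul_of_isElliptic_of_ringChar_eq W ℓ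
    (W.swanConductorAt_rationalTate_eq_wildConductorExponent_of_ringChar_eq_of_two_of_three ℓ h2 h3)

/-- **bsd.S15 (d), corrected ideal form, from Ogg's `p = 3` theorem alone, for a `W / ℚ` with no
additive place of residue characteristic `2`** (Saito's half is vacuous there).
[cite: SilvermanATAEC1994, §IV.10 Definition of the conductor (PDF p. 364) with Thm. IV.10.2 and Thm. IV.11.1, case p = 3 (pp. 358–371)] -/
theorem conductor_eq_conductorOf_mul_of_isElliptic_of_three_of_forall_not_hasAdditiveReductionAt_two
    (h3 : W.swanConductorAt_rationalTate_eq_wildConductorExponent_of_ringChar_eq_three ℓ)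
    (hna2 : ∀ v : HeightOneSpectrum (𝓞 ℚ), ringChar (𝓞 ℚ ⧸ v.asIdeal) = 2 →
      ¬ W.HasAdditiveReductionAt v) :
    conductor_eq_conductorOf_mul_of_isElliptic W ℓ :=
  conductor_eq_conductorOf_mul_of_isElliptic_of_ringChar_eq W ℓ
    (W.swanConductorAt_rationalTate_eq_wildConductorExponent_of_ringChar_eq_of_three_of_forall_not_hasAdditiveReductionAt_two
      ℓ h3 hna2)

/-- **bsd.S15 (d), corrected ideal form, from Ogg's `p = 3` theorem alone, for a `W / ℚ` with good
or multiplicative reduction at the place `v₂` above `2`** (`Rat.HeightOneSpectrum.primesEquiv`;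
the place of residue characteristic `2` is `v₂`, `eq_primesEquiv_symm_of_ringChar_eq`).
[cite: SilvermanATAEC1994, §IV.10 Definition of the conductor (PDF p. 364) with Thm. IV.10.2 and Thm. IV.11.1, case p = 3 (pp. 358–371)] -/
theorem conductor_eq_conductorOf_mul_of_isElliptic_of_three_of_not_hasAdditiveReductionAt_two
    (h3 : W.swanConductorAt_rationalTate_eq_wildConductorExponent_of_ringChar_eq_three ℓ)
    (h2 : ¬ W.HasAdditiveReductionAt
      ((Rat.HeightOneSpectrum.primesEquiv (R := 𝓞 ℚ)).symm ⟨2, Nat.prime_two⟩)) :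
    conductor_eq_conductorOf_mul_of_isElliptic W ℓ := by
  refine conductor_eq_conductorOf_mul_of_isElliptic_of_three_of_forall_not_hasAdditiveReductionAt_two
    W ℓ h3 fun v hv ↦ ?_
  rwa [eq_primesEquiv_symm_of_ringChar_eq v Nat.prime_two hv]

/-- **bsd.S15 (d), corrected ideal form, for a `W / ℚ` with good or multiplicative reduction at
`2` and at `3` — no hypothesis left.**  If `W` does not have additive reduction at the places
`v₂`, `v₃` of `𝓞 ℚ` above `2` and `3` (its reduction elsewhere being arbitrary), then for every
prime `ℓ`, for elliptic `W` and every continuity proof `h`,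
`𝔣(E/ℚ) = 𝔣^{(ℓ)}(V_ℓ E) · v_ℓ^{f_ℓ}`: Silverman *ATAEC* §IV.10, Definition of the conductor
(PDF p. 364) with Thm. IV.10.2(a) and (b) (*"If `E/K` has good or multiplicative reduction, or if
`p ≥ 5`, then `δ(E/K) = 0`"*, p. 358), all theorems of the tree; Ogg–Saito is not needed for such
a curve.  Place form of `conductor_eq_conductorOf_mul_of_isElliptic_of_forall_not_hasAdditiveReductionAt`
(`BSDConductorOggSaitoProofs`).
[cite: SilvermanATAEC1994, §IV.10 Definition of the conductor (PDF p. 364) with Thm. IV.10.2(a),(b) (pp. 358–362)] -/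
theorem conductor_eq_conductorOf_mul_of_isElliptic_of_not_hasAdditiveReductionAt_two_three
    (h2 : ¬ W.HasAdditiveReductionAt
      ((Rat.HeightOneSpectrum.primesEquiv (R := 𝓞 ℚ)).symm ⟨2, Nat.prime_two⟩))
    (h3 : ¬ W.HasAdditiveReductionAt
      ((Rat.HeightOneSpectrum.primesEquiv (R := 𝓞 ℚ)).symm ⟨3, Nat.prime_three⟩)) :
    conductor_eq_conductorOf_mul_of_isElliptic W ℓ := by
  refine conductor_eq_conductorOf_mul_of_isElliptic_of_forall_not_hasAdditiveReductionAt W ℓ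
    fun v hv ↦ ?_
  rcases hv with hv | hv
  · rwa [eq_primesEquiv_symm_of_ringChar_eq v Nat.prime_two hv]
  · rwa [eq_primesEquiv_symm_of_ringChar_eq v Nat.prime_three hv]

/-- **bsd.S15 (d), corrected ideal form, for semistable curves over `ℚ` — no hypothesis left**
(Silverman *ATAEC* Example 10.5: `𝔣(E/K) = ∏_{𝔭 ∣ 𝒟} 𝔭`; Thm. IV.10.2(a),(b) at the good and
multiplicative places are theorems, `InertiaInvariantsMultiplicativeProofs`).  From
`conductor_eq_conductorOf_mul_of_isElliptic_of_isSemistable_of_codim` (`BSDConductorIsEllipticProofs`)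
fed with `codimFixed_inertia_rationalTate_eq_one_of_hasMultiplicativeReductionAt_holds`.
[cite: SilvermanATAEC1994, Example 10.5 with Thm. IV.10.2(a),(b) (PDF pp. 358–364)] -/
theorem conductor_eq_conductorOf_mul_of_isElliptic_of_isSemistable (hs : W.IsSemistable (𝓞 ℚ)) :
    conductor_eq_conductorOf_mul_of_isElliptic W ℓ :=
  conductor_eq_conductorOf_mul_of_isElliptic_of_isSemistable_of_codim W ℓ hs
    (W.codimFixed_inertia_rationalTate_eq_one_of_hasMultiplicativeReductionAt_holds ℓ)

end Literature.NumberTheory.EllipticCurves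

/-! ### At `ℓ = p` the residue-characteristic-`p` half of the leaf is vacuous -/

namespace WeierstrassCurve

open Literature.NumberTheory.EllipticCurves

universe u

variable {K : Type u} [Field K] [NumberField K] (W : WeierstrassCurve K)

/-- **Saito's half of the leaf is vacuous at `ℓ = 2`.**  The `p = 2` half
`swanConductorAt_rationalTate_eq_wildConductorExponent_of_ringChar_eq_two W ℓ` of Ogg's formula for
the wild part (`HasseWeilAbelianConductorOggSaito`) only speaks about places `v ∤ ℓ`
(`(ℓ : 𝓞 K) ∉ v`), as it must: `V_ℓ E` is an `ℓ`-adic representation and Silverman *ATAEC* §IV.10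
fixes *"a prime `ℓ` different from `p`"* (Definition, PDF p. 358).  A place of residue
characteristic `2` contains `2` (`natCast_mem_of_ringChar_eq`), so at `ℓ = 2` the half has no
instance. [folklore] -/
theorem swanConductorAt_rationalTate_eq_wildConductorExponent_of_ringChar_eq_two_two :
    W.swanConductorAt_rationalTate_eq_wildConductorExponent_of_ringChar_eq_two 2 :=
  fun _ v hℓ _ h2 _ _ ↦ absurd (v.natCast_mem_of_ringChar_eq h2) hℓ

/-- **Ogg's half of the leaf is vacuous at `ℓ = 3`**: the `p = 3` half
`swanConductorAt_rationalTate_eq_wildConductorExponent_of_ringChar_eq_three W ℓ` only speaks about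
places `v ∤ ℓ`, and a place of residue characteristic `3` contains `3`. [folklore] -/
theorem swanConductorAt_rationalTate_eq_wildConductorExponent_of_ringChar_eq_three_three :
    W.swanConductorAt_rationalTate_eq_wildConductorExponent_of_ringChar_eq_three 3 :=
  fun _ v hℓ _ h3 _ _ ↦ absurd (v.natCast_mem_of_ringChar_eq h3) hℓ

/-- **At `ℓ = 2` the leaf is Ogg's `p = 3` theorem at `ℓ = 2`** — i.e. exactly the statement
Silverman proves on PDF pp. 366–371 (*"Let `L = K(E[2])` be the field generated by the
`2`-torsion points of `E`"*, p. 366; the wild part `δ` of Definition IV.10, p. 358, taken with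
`ℓ = 2`), Saito's half being vacuous at `ℓ = 2`
(`swanConductorAt_rationalTate_eq_wildConductorExponent_of_ringChar_eq_two_two`).  In particular the
leaf at `ℓ = 2` does not involve the `ℓ`-independence Thm. IV.10.2(c).
[cite: SilvermanATAEC1994, proof of IV.11.1, case p = 3 with ℓ = 2 (PDF pp. 366–371)] -/
theorem swanConductorAt_rationalTate_eq_wildConductorExponent_of_ringChar_eq_two_iff_three :
    W.swanConductorAt_rationalTate_eq_wildConductorExponent_of_ringChar_eq 2 ↔
      W.swanConductorAt_rationalTate_eq_wildConductorExponent_of_ringChar_eq_three 2 :=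
  ⟨W.swanConductorAt_rationalTate_eq_wildConductorExponent_of_ringChar_eq_three_of_ringChar_eq 2,
    W.swanConductorAt_rationalTate_eq_wildConductorExponent_of_ringChar_eq_of_two_of_three 2
      W.swanConductorAt_rationalTate_eq_wildConductorExponent_of_ringChar_eq_two_two⟩

/-- **At `ℓ = 3` the leaf is Saito's `p = 2` theorem at `ℓ = 3`**, Ogg's half being vacuous at
`ℓ = 3` (`swanConductorAt_rationalTate_eq_wildConductorExponent_of_ringChar_eq_three_three`).
[cite: SilvermanATAEC1994, IV.11.1 Ogg's formula (PDF p. 365), case p = 2 (p. 366, by reference to Saito)] -/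
theorem swanConductorAt_rationalTate_eq_wildConductorExponent_of_ringChar_eq_three_iff_two :
    W.swanConductorAt_rationalTate_eq_wildConductorExponent_of_ringChar_eq 3 ↔
      W.swanConductorAt_rationalTate_eq_wildConductorExponent_of_ringChar_eq_two 3 :=
  ⟨W.swanConductorAt_rationalTate_eq_wildConductorExponent_of_ringChar_eq_two_of_ringChar_eq 3,
    fun h2 ↦ W.swanConductorAt_rationalTate_eq_wildConductorExponent_of_ringChar_eq_of_two_of_three
      3 h2 W.swanConductorAt_rationalTate_eq_wildConductorExponent_of_ringChar_eq_three_three⟩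

end WeierstrassCurve

/-! ### The instances `ℓ = 2` and `ℓ = 3` of the fact over `ℚ` -/

namespace Literature.NumberTheory.EllipticCurves

open WeierstrassCurve

variable (W : WeierstrassCurve ℚ)

/-- **bsd.S15 (d), corrected ideal form, at `ℓ = 2`, for every `W / ℚ`, from Ogg's `p = 3`
theorem at `ℓ = 2` alone**: `𝔣(E/ℚ) = 𝔣^{(2)}(V_2 E) · v_2^{f_2}` for elliptic `W` follows from
the residue-characteristic-`3` half of the leaf at `ℓ = 2` — the statement printed and proved in
Silverman *ATAEC*, pp. 366–371, with `L = ℚ(E[2])` — because the place `2`, where Saito's theorem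
would be needed, is the exempted place `v_ℓ` (its half of the leaf is vacuous at `ℓ = 2`,
`swanConductorAt_rationalTate_eq_wildConductorExponent_of_ringChar_eq_two_two`).  Neither Saito's
theorem nor Thm. IV.10.2(c) enters this instance.
[cite: SilvermanATAEC1994, §IV.10 Definition of the conductor (PDF p. 364) with Thm. IV.10.2(a),(b) and IV.11.1, case p = 3 with ℓ = 2 (pp. 358–371)] -/
theorem conductor_eq_conductorOf_mul_of_isElliptic_two_of_three
    (h3 : W.swanConductorAt_rationalTate_eq_wildConductorExponent_of_ringChar_eq_three 2) :
    conductor_eq_conductorOf_mul_of_isElliptic W 2 :=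
  conductor_eq_conductorOf_mul_of_isElliptic_of_two_of_three W 2
    W.swanConductorAt_rationalTate_eq_wildConductorExponent_of_ringChar_eq_two_two h3

/-- **bsd.S15 (d), corrected ideal form, at `ℓ = 3`, for every `W / ℚ`, from Saito's `p = 2`
theorem at `ℓ = 3` alone** (Ogg's half is vacuous at `ℓ = 3`: the place `3` is the exempted
place `v_ℓ`).
[cite: SilvermanATAEC1994, §IV.10 Definition of the conductor (PDF p. 364) with Thm. IV.10.2(a),(b) and IV.11.1, case p = 2 (pp. 358–366)] -/
theorem conductor_eq_conductorOf_mul_of_isElliptic_three_of_two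
    (h2 : W.swanConductorAt_rationalTate_eq_wildConductorExponent_of_ringChar_eq_two 3) :
    conductor_eq_conductorOf_mul_of_isElliptic W 3 :=
  conductor_eq_conductorOf_mul_of_isElliptic_of_two_of_three W 3 h2
    W.swanConductorAt_rationalTate_eq_wildConductorExponent_of_ringChar_eq_three_three

/-! ### Fact decomposition record (librarian `fact-decompose`, 2026-08-16) -/

/-- **Assembly of the split of `conductor_eq_conductorOf_mul_of_isElliptic`** (bsd.S15 (d),
corrected ideal form `𝔣(E/ℚ) = 𝔣^{(ℓ)}(V_ℓ E) · v_ℓ^{f_ℓ}`; budget-capped fact, human ruling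
2026-08-16). Along Silverman's Chapter IV route every input is a theorem of the tree except Ogg's
formula for the wild part at the additive places of residue characteristic `2` and `3`; so the two
children of the split are the two named halves of that leaf (`HasseWeilAbelianConductorOggSaito`):
Saito's `p = 2` theorem `swanConductorAt_rationalTate_eq_wildConductorExponent_of_ringChar_eq_two W ℓ`
(Saito 1988, Thm. 1, cited by *ATAEC* p. 366) and Ogg's `p = 3` theorem
`swanConductorAt_rationalTate_eq_wildConductorExponent_of_ringChar_eq_three W ℓ` (Ogg 1967; proved
in *ATAEC* pp. 366–371), for the same `W`, `ℓ`; the glue is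
`conductor_eq_conductorOf_mul_of_isElliptic_of_two_of_three`. At `ℓ = 2` (resp. `ℓ = 3`) only the
second (resp. first) child is needed (`conductor_eq_conductorOf_mul_of_isElliptic_two_of_three`,
`…_three_of_two`).
[cite: SilvermanATAEC1994, §IV.10 Definition of the conductor (PDF p. 364) with Thm. IV.10.2 and Thm. IV.11.1 (pp. 358–371)]
[cite: Saito1988, Theorem 1, case of elliptic curves] [cite: OggAJM1967, conductor–discriminant formula] -/
theorem conductor_eq_conductorOf_mul_of_isElliptic_holds_of (ℓ : ℕ) [Fact ℓ.Prime] :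
    W.swanConductorAt_rationalTate_eq_wildConductorExponent_of_ringChar_eq_two ℓ →
      W.swanConductorAt_rationalTate_eq_wildConductorExponent_of_ringChar_eq_three ℓ →
        conductor_eq_conductorOf_mul_of_isElliptic W ℓ :=
  fun h2 h3 => conductor_eq_conductorOf_mul_of_isElliptic_of_two_of_three W ℓ h2 h3

end Literature.NumberTheory.EllipticCurves

end
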